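import Mathlib
import Summits.Ventures.PercRepro2.TypedStarK5

/-!
# THE PLACEMENT SUM IS SYMMETRIC IN THE STAR EDGES (blind cell PercRepro2, p2 g2, 2026-08-25)

Exchanging two star edges — their neighbours and their types together — does not change the
placement sum `starSum` (the nested sums commute, and the star mask is symmetric: `starMask_swap12`,
`starMask_swap23`).  Hence `StarNonneg` at a neighbourhood `(p₁, p₂, p₃)` follows from `StarNonneg` at
any permutation of it with the types permuted alongside (`StarNonneg.swap12`, `StarNonneg.swap23`), and
the certificates at the SORTED neighbourhoods suffice (`starNonneg_of_sorted`).

Own code; standard axioms.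
-/

namespace Summit.Ventures.PercRepro2

open Hub

namespace K5

section Symm

variable {R : Type*} [Field R]

/-- `pairMask` is symmetric. -/
lemma pairMask_swap (x y : Fin 5) : pairMask x y = pairMask y x := by
  funext j
  rw [Bool.eq_iff_iff, pairMask_eq_true_iff, pairMask_eq_true_iff, Sym2.eq_swap]

/-- The star mask is symmetric under exchanging the first two edges. -/
lemma starMask_swap12 (p₁ p₂ p₃ : Fin 5) (a a' a'' : Bool) :
    starMask p₁ p₂ p₃ a a' a'' = starMask p₂ p₁ p₃ a' a a'' := by
  funext j
  unfold starMask
  rw [pairMask_swap p₂ p₁]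
  cases a <;> cases a' <;> cases a'' <;> simp [Bool.or_comm, Bool.or_left_comm, Bool.or_assoc]

/-- The star mask is symmetric under exchanging the last two edges. -/
lemma starMask_swap23 (p₁ p₂ p₃ : Fin 5) (a a' a'' : Bool) :
    starMask p₁ p₂ p₃ a a' a'' = starMask p₁ p₃ p₂ a a'' a' := by
  funext j
  unfold starMask
  rw [pairMask_swap p₃ p₂]
  cases a <;> cases a' <;> cases a'' <;> simp [Bool.or_comm, Bool.or_assoc]

/-- The weight of a placement. -/
def wt3 (A : Bool × Bool × Bool) : ℕ := A.1.toNat + A.2.1.toNat + A.2.2.toNat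

/-- The placement sum as one sum over the three placements (one per star edge). -/
noncomputable def starSum' (F : Finset (Fin 10)) (z : Config (Fin 10)) (τ : Fin 10 → ℕ)
    (p₁ p₂ p₃ : Fin 5) (t₁ t₂ t₃ : ℕ) (K : Config (Fin 10) → Config (Fin 10) → Config (Fin 10) → R) : R :=
  ∑ A : Bool × Bool × Bool, ∑ B : Bool × Bool × Bool, ∑ C : Bool × Bool × Bool,
    if wt3 A = t₁ ∧ wt3 B = t₂ ∧ wt3 C = t₃ then
      typedCount F z τ (fun x y w =>
        K (orOn (starMask p₁ p₂ p₃ A.1 B.1 C.1) x) (orOn (starMask p₁ p₂ p₃ A.2.1 B.2.1 C.2.1) y)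
          (orOn (starMask p₁ p₂ p₃ A.2.2 B.2.2 C.2.2) w))
    else 0

/-- `starSum = starSum'`. -/
lemma starSum_eq_starSum' (F : Finset (Fin 10)) (z : Config (Fin 10)) (τ : Fin 10 → ℕ)
    (p₁ p₂ p₃ : Fin 5) (t₁ t₂ t₃ : ℕ) (K : Config (Fin 10) → Config (Fin 10) → Config (Fin 10) → R) :
    starSum F z τ p₁ p₂ p₃ t₁ t₂ t₃ K = starSum' F z τ p₁ p₂ p₃ t₁ t₂ t₃ K := by
  unfold starSum starSum'
  simp only [Fintype.sum_prod_type, wt3]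
  refine Finset.sum_congr rfl fun a _ => Finset.sum_congr rfl fun b _ =>
    Finset.sum_congr rfl fun c _ => ?_
  by_cases hA : a.toNat + b.toNat + c.toNat = t₁
  · rw [if_pos hA]
    refine Finset.sum_congr rfl fun a' _ => Finset.sum_congr rfl fun b' _ =>
      Finset.sum_congr rfl fun c' _ => ?_
    by_cases hB : a'.toNat + b'.toNat + c'.toNat = t₂
    · rw [if_pos hB]
      refine Finset.sum_congr rfl fun a'' _ => Finset.sum_congr rfl fun b'' _ =>
        Finset.sum_congr rfl fun c'' _ => ?_
      by_cases hC : a''.toNat + b''.toNat + c''.toNat = t₃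
      · rw [if_pos hC, if_pos ⟨hA, hB, hC⟩]
      · rw [if_neg hC, if_neg (fun h => hC h.2.2)]
    · rw [if_neg hB]
      symm
      refine Finset.sum_eq_zero fun a'' _ => Finset.sum_eq_zero fun b'' _ =>
        Finset.sum_eq_zero fun c'' _ => ?_
      rw [if_neg (fun h => hB h.2.1)]
  · rw [if_neg hA]
    symm
    refine Finset.sum_eq_zero fun a' _ => Finset.sum_eq_zero fun b' _ =>
      Finset.sum_eq_zero fun c' _ => Finset.sum_eq_zero fun a'' _ => Finset.sum_eq_zero fun b'' _ =>
      Finset.sum_eq_zero fun c'' _ => ?_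
    rw [if_neg (fun h => hA h.1)]

/-- **Exchanging the first two star edges.** -/
theorem starSum_swap12 (F : Finset (Fin 10)) (z : Config (Fin 10)) (τ : Fin 10 → ℕ) (p₁ p₂ p₃ : Fin 5)
    (t₁ t₂ t₃ : ℕ) (K : Config (Fin 10) → Config (Fin 10) → Config (Fin 10) → R) :
    starSum F z τ p₁ p₂ p₃ t₁ t₂ t₃ K = starSum F z τ p₂ p₁ p₃ t₂ t₁ t₃ K := by
  rw [starSum_eq_starSum', starSum_eq_starSum']
  unfold starSum'
  refine (Finset.sum_comm).trans ?_
  refine Finset.sum_congr rfl fun B _ => Finset.sum_congr rfl fun A _ =>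
    Finset.sum_congr rfl fun C _ => ?_
  rw [starMask_swap12 p₁ p₂ p₃ A.1 B.1 C.1, starMask_swap12 p₁ p₂ p₃ A.2.1 B.2.1 C.2.1,
    starMask_swap12 p₁ p₂ p₃ A.2.2 B.2.2 C.2.2]
  by_cases h : wt3 A = t₁ ∧ wt3 B = t₂ ∧ wt3 C = t₃
  · rw [if_pos h, if_pos ⟨h.2.1, h.1, h.2.2⟩]
  · rw [if_neg h, if_neg (fun h' => h ⟨h'.2.1, h'.1, h'.2.2⟩)]

/-- **Exchanging the last two star edges.** -/
theorem starSum_swap23 (F : Finset (Fin 10)) (z : Config (Fin 10)) (τ : Fin 10 → ℕ) (p₁ p₂ p₃ : Fin 5)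
    (t₁ t₂ t₃ : ℕ) (K : Config (Fin 10) → Config (Fin 10) → Config (Fin 10) → R) :
    starSum F z τ p₁ p₂ p₃ t₁ t₂ t₃ K = starSum F z τ p₁ p₃ p₂ t₁ t₃ t₂ K := by
  rw [starSum_eq_starSum', starSum_eq_starSum']
  unfold starSum'
  refine Finset.sum_congr rfl fun A _ => ?_
  refine (Finset.sum_comm).trans ?_
  refine Finset.sum_congr rfl fun C _ => Finset.sum_congr rfl fun B _ => ?_
  rw [starMask_swap23 p₁ p₂ p₃ A.1 B.1 C.1, starMask_swap23 p₁ p₂ p₃ A.2.1 B.2.1 C.2.1,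
    starMask_swap23 p₁ p₂ p₃ A.2.2 B.2.2 C.2.2]
  by_cases h : wt3 A = t₁ ∧ wt3 B = t₂ ∧ wt3 C = t₃
  · rw [if_pos h, if_pos ⟨h.1, h.2.2, h.2.1⟩]
  · rw [if_neg h, if_neg (fun h' => h ⟨h'.1, h'.2.2, h'.2.1⟩)]

end Symm

section Closure

variable {R : Type*} [Field R] [LinearOrder R]

/-- `StarNonneg` under the exchange of the first two star edges. -/
theorem StarNonneg.swap12 {o a₁ a₂ a₃ b p₁ p₂ p₃ : Fin 5} {t₁ t₂ t₃ : ℕ}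
    (h : StarNonneg R o a₁ a₂ a₃ b p₂ p₁ p₃ t₂ t₁ t₃) : StarNonneg R o a₁ a₂ a₃ b p₁ p₂ p₃ t₁ t₂ t₃ := by
  intro F τ hF
  rw [starSum_swap12]
  exact h F τ hF

/-- `StarNonneg` under the exchange of the last two star edges. -/
theorem StarNonneg.swap23 {o a₁ a₂ a₃ b p₁ p₂ p₃ : Fin 5} {t₁ t₂ t₃ : ℕ}
    (h : StarNonneg R o a₁ a₂ a₃ b p₁ p₃ p₂ t₁ t₃ t₂) : StarNonneg R o a₁ a₂ a₃ b p₁ p₂ p₃ t₁ t₂ t₃ := by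
  intro F τ hF
  rw [starSum_swap23]
  exact h F τ hF

/-- **From the sorted neighbourhoods to all**: for a permutation-invariant family `Q` of triples, if
`StarNonneg` holds at every sorted triple `q₁ < q₂ < q₃` of the family and every type vector, it holds
at every triple of distinct marks of the family in any order. -/
theorem starNonneg_of_sorted {o a₁ a₂ a₃ b : Fin 5} (Q : Fin 5 → Fin 5 → Fin 5 → Prop)
    (hQ12 : ∀ x y z, Q x y z → Q y x z) (hQ23 : ∀ x y z, Q x y z → Q x z y)
    (hs : ∀ q₁ q₂ q₃ : Fin 5, Q q₁ q₂ q₃ → q₁ < q₂ → q₂ < q₃ → ∀ t₁ t₂ t₃ : ℕ,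
      (t₁ = 1 ∨ t₁ = 2) → (t₂ = 1 ∨ t₂ = 2) → (t₃ = 1 ∨ t₃ = 2) →
      StarNonneg R o a₁ a₂ a₃ b q₁ q₂ q₃ t₁ t₂ t₃)
    (p₁ p₂ p₃ : Fin 5) (hp : Q p₁ p₂ p₃) (h12 : p₁ ≠ p₂) (h13 : p₁ ≠ p₃)
    (h23 : p₂ ≠ p₃) (t₁ t₂ t₃ : ℕ) (ht₁ : t₁ = 1 ∨ t₁ = 2) (ht₂ : t₂ = 1 ∨ t₂ = 2)
    (ht₃ : t₃ = 1 ∨ t₃ = 2) : StarNonneg R o a₁ a₂ a₃ b p₁ p₂ p₃ t₁ t₂ t₃ := by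
  rcases lt_or_gt_of_ne h12 with h12 | h12 <;> rcases lt_or_gt_of_ne h13 with h13 | h13 <;>
    rcases lt_or_gt_of_ne h23 with h23 | h23
  · -- p₁ < p₂ < p₃
    exact hs p₁ p₂ p₃ hp h12 h23 t₁ t₂ t₃ ht₁ ht₂ ht₃
  · -- p₁ < p₃ < p₂
    exact StarNonneg.swap23 (hs p₁ p₃ p₂ (hQ23 _ _ _ hp) h13 h23 t₁ t₃ t₂ ht₁ ht₃ ht₂)
  · exact absurd (h13.trans (h12.trans h23)) (lt_irrefl _)
  · -- p₃ < p₁ < p₂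
    exact StarNonneg.swap23 (StarNonneg.swap12 (hs p₃ p₁ p₂ (hQ12 _ _ _ (hQ23 _ _ _ hp)) h13 h12 t₃ t₁ t₂
      ht₃ ht₁ ht₂))
  · -- p₂ < p₁ < p₃
    exact StarNonneg.swap12 (hs p₂ p₁ p₃ (hQ12 _ _ _ hp) h12 h13 t₂ t₁ t₃ ht₂ ht₁ ht₃)
  · exact absurd (h12.trans (h13.trans h23)) (lt_irrefl _)
  · -- p₂ < p₃ < p₁
    exact StarNonneg.swap12 (StarNonneg.swap23 (hs p₂ p₃ p₁ (hQ23 _ _ _ (hQ12 _ _ _ hp)) h23 h13 t₂ t₃ t₁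
      ht₂ ht₃ ht₁))
  · -- p₃ < p₂ < p₁
    exact StarNonneg.swap12 (StarNonneg.swap23 (StarNonneg.swap12
      (hs p₃ p₂ p₁ (hQ12 _ _ _ (hQ23 _ _ _ (hQ12 _ _ _ hp))) h23 h12 t₃ t₂ t₁ ht₃ ht₂ ht₁)))

end Closure

end K5

end Summit.Ventures.PercRepro2
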